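import Summits.QuantumFields.BalabanUV.Beta.GAN24.LayerSeamLetters

/-!
# (R-iv) seam letters, PART 2 — the seam cell as a superposition over blocks

G-an2-4 / CT-W, (LT) «LAYER TRANSPORT» row, key K-LL-4 (the gauge cells of the dressed legs).
PART 1 (`LayerSeamLetters`) showed, entry by entry, that the vertex of a BLOCK-CONSTANT table gauge
`(ν,U) ↦ dz (Λ_{νU} ∘ blk M)` against a slot-Ward companion `S₀` is the superposition
`Σ_B Λ_{νU} B · [S₀, 𝟙_B]` of block-INDICATOR commutators.  This file carries the decomposition
through the two-leg push on the summable class: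

* §1 block regrouping (`tsum_blockConst_mul`): `Σ'_y F y · Λ(blk y) = Σ'_B Λ B · Σ'_y 𝟙_B(y) F y`
  for summable `F` and bounded block values (fiberwise `HasSum` over `blk M`);
* §2 the antisymmetric version on `Site × Site` (`tsum_tsum_mul_blockConst_sub`):
  `Σ'_z Σ'_x G(x,z)·(Λ(blk z) − Λ(blk x)) = Σ'_B Λ B · Σ'_z Σ'_x G(x,z)·(𝟙_B z − 𝟙_B x)`;
* §3 the (b3) cell: `push₃ l r (dz(Λ∘blk)) S = Σ'_B Λ_{νU} B · ⟨l ⊗ r, [S₀, 𝟙_B]⟩`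
  (`push₃_blockGauge_eq_tsum_blocks`), with the pairing `G(x,z) = Σ_{κ₂κ₁} l·S₀·r` summable on
  `Site × Site` when the left leg has summable rows, the companion decays off the diagonal and the
  right leg is bounded (`summable_pairing`).

No estimate is made here; the COUNT socket (per-block BiLoc of the indicator-commutator pushes,
weighted by `Σ'_B |Λ_{νU} B|·w_B`) is PART 3.  [folklore] summation algebra throughout; nothing of
(Q-R)/(LT)/(S) is discharged.
-/

noncomputable section

open Finset
open scoped BigOperators
open Literature.MathematicalPhysics.QuantumFieldTheory
open Literature.MathematicalPhysics.QuantumFieldTheory.Balaban1983to89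
open Literature.MathematicalPhysics.QuantumFieldTheory.Balaban1983to89.Beta
open ExpKernelCalculus (MKer Site)
open AveragingContours (blk)
open AffineAveraging (dz)
open OneStepResolventKernel (Fib)
open Summit.QuantumFields.BalabanUV.Beta.ChartConjugation (conjV)
open Summit.QuantumFields.BalabanUV.Beta.BorderedHessian (diagK conjV_diagK_apply)
open Summit.QuantumFields.BalabanUV.Beta.GAN24.Push3 (push₃)
open Summit.QuantumFields.BalabanUV.Beta.GAN24.LayerPushGaugeTable (push₃_gaugeTable_inl_inl)

namespace Summit.QuantumFields.BalabanUV.Beta.GAN24.LayerSeamLettersFubini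

variable {d : ℕ}

/-! ## §1 Block regrouping -/

open Classical in
/-- [folklore] **BLOCK REGROUPING**: a summable function weighted by a BOUNDED block-constant factor, summed over the lattice, is the sum over block labels of the
block value times the function's sum over that block. -/
theorem tsum_blockConst_mul (M : ℕ) (Λ : Site (d + 1) → ℝ) {F : Site (d + 1) → ℝ}
    (hΛF : Summable fun z => Λ (blk M z) * F z) :
    ∑' z, Λ (blk M z) * F z = ∑' B : Site (d + 1), Λ B * ∑' z, (if blk M z = B then F z else 0) := by
  have h := hΛF.hasSum.tsum_fiberwise (blk M)
  rw [← h.tsum_eq]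
  refine tsum_congr fun B => ?_
  have e1 : (fun z : ↥((blk M) ⁻¹' {B}) => Λ (blk M (z : Site (d + 1))) * F z)
      = fun z : ↥((blk M) ⁻¹' {B}) => Λ B * F (z : Site (d + 1)) := by
    funext z
    have hz : blk M (z : Site (d + 1)) = B := z.2
    rw [hz]
  rw [e1, tsum_mul_left, tsum_subtype ((blk M) ⁻¹' {B}) F]
  congr 1
  refine tsum_congr fun z => ?_
  by_cases hz : blk M z = B
  · rw [if_pos hz, Set.indicator_of_mem (by simpa using hz)]
  · rw [if_neg hz, Set.indicator_of_notMem (by simpa using hz)]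

/-- [folklore] A bounded block-constant factor keeps summability. -/
theorem summable_blockConst_mul (M : ℕ) {Λ : Site (d + 1) → ℝ} {Λbar : ℝ} (hΛ : ∀ B, |Λ B| ≤ Λbar) {F : Site (d + 1) → ℝ}
    (hF : Summable F) : Summable fun z => Λ (blk M z) * F z := by
  refine Summable.of_norm_bounded (hF.abs.mul_left Λbar) (fun z => ?_)
  rw [Real.norm_eq_abs, abs_mul]
  exact mul_le_mul_of_nonneg_right (hΛ _) (abs_nonneg _)


open Classical in
/-- [folklore] The indicator series over a block equals the series over the block as a subtype. -/
theorem tsum_ite_block_eq_tsum_subtype (M : ℕ) (B : Site (d + 1)) (F : Site (d + 1) → ℝ) :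
    ∑' z, (if blk M z = B then F z else 0) = ∑' z : ↥((blk M) ⁻¹' {B}), F (z : Site (d + 1)) := by
  rw [tsum_subtype ((blk M) ⁻¹' {B}) F]
  refine tsum_congr fun z => ?_
  by_cases hz : blk M z = B
  · rw [if_pos hz, Set.indicator_of_mem (by simpa using hz)]
  · rw [if_neg hz, Set.indicator_of_notMem (by simpa using hz)]

open Classical in
/-- [folklore] The block sums of a summable function form a summable family over block labels (times bounded block values). -/
theorem summable_blockLabel (M : ℕ) {Λ : Site (d + 1) → ℝ} {Λbar : ℝ} (hΛ : ∀ B, |Λ B| ≤ Λbar) {F : Site (d + 1) → ℝ} (hF : Summable F) :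
    Summable fun B : Site (d + 1) => Λ B * ∑' z, (if blk M z = B then F z else 0) := by
  have h := (hF.hasSum.tsum_fiberwise (blk M)).summable
  refine Summable.of_norm_bounded ((h.abs.mul_left Λbar)) (fun B => ?_)
  rw [Real.norm_eq_abs, abs_mul, tsum_ite_block_eq_tsum_subtype M B F]
  exact mul_le_mul_of_nonneg_right (hΛ B) (abs_nonneg _)

/-! ## §2 The commutator weight against a summable pair function: the linear decomposition over blocks -/

open Classical in
/-- [folklore] For a summable pair function `G` on `Site × Site` and a bounded weight `c` on sites: `Σ'_z Σ'_x G(x,z)·c z = Σ'_z c z·Σ'_x G(x,z)` (pull the constant out of the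
inner series). -/
theorem tsum_tsum_mul_right_eq {G : Site (d + 1) × Site (d + 1) → ℝ} (c : Site (d + 1) → ℝ) :
    ∑' z, ∑' x, G (x, z) * c z = ∑' z, c z * ∑' x, G (x, z) := by
  refine tsum_congr fun z => ?_
  rw [tsum_mul_right, mul_comm]

/-- [folklore] A bounded weight on the FIRST variable keeps pair summability. -/
theorem summable_mul_weight_fst {G : Site (d + 1) × Site (d + 1) → ℝ} (hG : Summable G) {c : Site (d + 1) → ℝ} {cbar : ℝ} (hc : ∀ x, |c x| ≤ cbar) :
    Summable fun p : Site (d + 1) × Site (d + 1) => G p * c p.1 := by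
  refine Summable.of_norm_bounded (hG.abs.mul_right cbar) (fun p => ?_)
  rw [Real.norm_eq_abs, abs_mul]
  exact mul_le_mul_of_nonneg_left (hc _) (abs_nonneg _)

/-- [folklore] A bounded weight on the SECOND variable keeps pair summability. -/
theorem summable_mul_weight_snd {G : Site (d + 1) × Site (d + 1) → ℝ} (hG : Summable G) {c : Site (d + 1) → ℝ} {cbar : ℝ} (hc : ∀ z, |c z| ≤ cbar) :
    Summable fun p : Site (d + 1) × Site (d + 1) => G p * c p.2 := by
  refine Summable.of_norm_bounded (hG.abs.mul_right cbar) (fun p => ?_)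
  rw [Real.norm_eq_abs, abs_mul]
  exact mul_le_mul_of_nonneg_left (hc _) (abs_nonneg _)

/-- [folklore] For a summable pair function `G` and a bounded weight `c`: `Σ'_z Σ'_x G(x,z)·c x = Σ'_x c x·Σ'_z G(x,z)` (Fubini, `Summable.tsum_comm`). -/
theorem tsum_tsum_mul_left_eq {G : Site (d + 1) × Site (d + 1) → ℝ} (hG : Summable G) {c : Site (d + 1) → ℝ} {cbar : ℝ} (hc : ∀ x, |c x| ≤ cbar) :
    ∑' z, ∑' x, G (x, z) * c x = ∑' x, c x * ∑' z, G (x, z) := by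
  have hs : Summable (Function.uncurry fun x z => G (x, z) * c x) := by
    refine (summable_mul_weight_fst hG hc).congr fun p => ?_
    rcases p with ⟨x, z⟩; rfl
  rw [hs.tsum_comm]
  refine tsum_congr fun x => ?_
  rw [tsum_mul_right, mul_comm]

open Classical in
/-- NOT IN PRINT; OUR BOOKKEEPING.  **THE LINEAR DECOMPOSITION OVER BLOCKS**: for a summable pair function `G` and BOUNDED block values `Λ`,
`Σ'_z Σ'_x G(x,z)·(Λ(blk z) − Λ(blk x)) = Σ'_B Λ B · Σ'_z Σ'_x G(x,z)·(𝟙_B z − 𝟙_B x)` — the pairing of `G` against the commutator weight of a block-constant function is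
the superposition over block labels of its pairings against the block-INDICATOR commutator weights. -/
theorem tsum_tsum_mul_blockConst_sub (M : ℕ) {Λ : Site (d + 1) → ℝ} {Λbar : ℝ} (hΛ : ∀ B, |Λ B| ≤ Λbar)
    {G : Site (d + 1) × Site (d + 1) → ℝ} (hG : Summable G) :
    ∑' z, ∑' x, G (x, z) * (Λ (blk M z) - Λ (blk M x))
      = ∑' B : Site (d + 1), Λ B * ∑' z, ∑' x, G (x, z) * ((if blk M z = B then (1 : ℝ) else 0) - (if blk M x = B then (1 : ℝ) else 0)) := by
  -- summability bookkeeping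
  have hGz : Summable fun z => ∑' x, G (x, z) := hG.prod_symm.prod
  have hGx : Summable fun x => ∑' z, G (x, z) := hG.prod
  have hfz : ∀ z, Summable fun x => G (x, z) := fun z => hG.prod_symm.prod_factor z
  have hind : ∀ B : Site (d + 1), ∀ y : Site (d + 1), |(if blk M y = B then (1 : ℝ) else 0)| ≤ 1 := fun B y => by split_ifs <;> simp
  -- split LHS
  have eL : ∀ z, ∑' x, G (x, z) * (Λ (blk M z) - Λ (blk M x)) = (∑' x, G (x, z) * Λ (blk M z)) - ∑' x, G (x, z) * Λ (blk M x) := by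
    intro z
    rw [← Summable.tsum_sub ((hfz z).mul_right _) ?_]
    · exact tsum_congr fun x => by ring
    · exact Summable.of_norm_bounded ((hfz z).abs.mul_right Λbar) fun x => by
        rw [Real.norm_eq_abs, abs_mul]; exact mul_le_mul_of_nonneg_left (hΛ _) (abs_nonneg _)
  have hs1 : Summable fun z => ∑' x, G (x, z) * Λ (blk M z) := by
    have := (summable_mul_weight_snd hG (c := fun z => Λ (blk M z)) fun z => hΛ _).prod_symm.prod
    exact this
  have hs2 : Summable fun z => ∑' x, G (x, z) * Λ (blk M x) := by
    have := (summable_mul_weight_fst hG (c := fun x => Λ (blk M x)) fun x => hΛ _).prod_symm.prod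
    exact this
  rw [tsum_congr eL, Summable.tsum_sub hs1 hs2]
  -- T1 and T2 by block regrouping
  have T1 : ∑' z, ∑' x, G (x, z) * Λ (blk M z) = ∑' B : Site (d + 1), Λ B * ∑' z, (if blk M z = B then (∑' x, G (x, z)) else 0) := by
    rw [tsum_tsum_mul_right_eq]
    exact tsum_blockConst_mul M Λ (summable_blockConst_mul M hΛ hGz)
  have T2 : ∑' z, ∑' x, G (x, z) * Λ (blk M x) = ∑' B : Site (d + 1), Λ B * ∑' x, (if blk M x = B then (∑' z, G (x, z)) else 0) := by
    rw [tsum_tsum_mul_left_eq hG (c := fun x => Λ (blk M x)) fun x => hΛ _]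
    exact tsum_blockConst_mul M Λ (summable_blockConst_mul M hΛ hGx)
  rw [T1, T2]
  -- summability over block labels of the two regrouped families (fiberwise sums of summable families)
  have hB1 : Summable fun B : Site (d + 1) => Λ B * ∑' z, (if blk M z = B then (∑' x, G (x, z)) else 0) :=
    summable_blockLabel M hΛ hGz
  have hB2 : Summable fun B : Site (d + 1) => Λ B * ∑' x, (if blk M x = B then (∑' z, G (x, z)) else 0) :=
    summable_blockLabel M hΛ hGx
  rw [← Summable.tsum_sub hB1 hB2]
  refine tsum_congr fun B => ?_
  rw [← mul_sub]
  congr 1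
  -- per block: the indicator commutator weight, split the same way
  have eR : ∀ z, ∑' x, G (x, z) * ((if blk M z = B then (1 : ℝ) else 0) - (if blk M x = B then (1 : ℝ) else 0))
      = (∑' x, G (x, z) * (if blk M z = B then (1 : ℝ) else 0)) - ∑' x, G (x, z) * (if blk M x = B then (1 : ℝ) else 0) := by
    intro z
    rw [← Summable.tsum_sub ((hfz z).mul_right _) ?_]
    · exact tsum_congr fun x => by ring
    · exact Summable.of_norm_bounded ((hfz z).abs.mul_right 1) fun x => by
        rw [Real.norm_eq_abs, abs_mul]; exact mul_le_mul_of_nonneg_left (hind B _) (abs_nonneg _)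
  have hr1 : Summable fun z => ∑' x, G (x, z) * (if blk M z = B then (1 : ℝ) else 0) :=
    (summable_mul_weight_snd hG (c := fun z => if blk M z = B then (1 : ℝ) else 0) fun z => hind B _).prod_symm.prod
  have hr2 : Summable fun z => ∑' x, G (x, z) * (if blk M x = B then (1 : ℝ) else 0) :=
    (summable_mul_weight_fst hG (c := fun x => if blk M x = B then (1 : ℝ) else 0) fun x => hind B _).prod_symm.prod
  rw [tsum_congr eR, Summable.tsum_sub hr1 hr2, tsum_tsum_mul_right_eq,
    tsum_tsum_mul_left_eq hG (c := fun x => if blk M x = B then (1 : ℝ) else 0) fun x => hind B _]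
  congr 1
  · exact tsum_congr fun z => by split_ifs <;> simp
  · exact tsum_congr fun x => by split_ifs <;> simp


/-! ## §3 The (b3) seam cell as a superposition over blocks -/

section Cell

variable {l r : Fin (d + 1) → (Fin (d + 1) → ℤ) → Fin (d + 1) → (Fin (d + 1) → ℤ) → ℝ}
  {S : Fin (d + 1) → (Fin (d + 1) → ℤ) → MKer (d + 1) (Fib d)} {S₀ : MKer (d + 1) (Fib d)}
  (hWard : ∀ (ψ : (Fin (d + 1) → ℤ) → ℝ) (x z : Fin (d + 1) → ℤ) (κ₁ κ₂ : Fin (d + 1)),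
    ∑ κ : Fin (d + 1), ∑' u : Fin (d + 1) → ℤ, dz ψ κ u * S κ u x z (Sum.inl κ₁) (Sum.inl κ₂)
      = S₀ x z (Sum.inl κ₁) (Sum.inl κ₂) * (ψ z - ψ x))
  (M : ℕ) (Λ : Fin (d + 1) → (Fin (d + 1) → ℤ) → Site (d + 1) → ℝ)

/-- [folklore] The product of a summable-row left leg, a bounded companion column and a bounded right leg entry, weighted by a bounded function, is summable in the left
kernel index. -/
theorem summable_legProd_fst {C₀ Cr w : ℝ} (hls : ∀ α x' κ, Summable fun x => l α x' κ x) (hS₀ : ∀ x z a b, |S₀ x z a b| ≤ C₀) (hr : ∀ β z' κ z, |r β z' κ z| ≤ Cr)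
    {c : Site (d + 1) → ℝ} (hc : ∀ x, |c x| ≤ w) (α β : Fin (d + 1)) (x' z' z : Site (d + 1)) (κ₁ κ₂ : Fin (d + 1)) :
    Summable fun x => l α x' κ₁ x * S₀ x z (Sum.inl κ₁) (Sum.inl κ₂) * r β z' κ₂ z * c x := by
  refine Summable.of_norm_bounded (((hls α x' κ₁).abs.mul_right (C₀ * Cr * w))) (fun x => ?_)
  rw [Real.norm_eq_abs, abs_mul, abs_mul, abs_mul]
  have h1 := hS₀ x z (Sum.inl κ₁) (Sum.inl κ₂)
  have h2 := hr β z' κ₂ z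
  have h3 := hc x
  have h0 : 0 ≤ C₀ := (abs_nonneg _).trans h1
  have h0' : 0 ≤ Cr := (abs_nonneg _).trans h2
  calc |l α x' κ₁ x| * |S₀ x z (Sum.inl κ₁) (Sum.inl κ₂)| * |r β z' κ₂ z| * |c x|
      ≤ |l α x' κ₁ x| * C₀ * Cr * w := by gcongr
    _ = |l α x' κ₁ x| * (C₀ * Cr * w) := by ring

include hWard in
open Classical in
/-- NOT IN PRINT; OUR BOOKKEEPING (`LayerPushGaugeTable.push₃_gaugeTable_inl_inl`, finite sums through the `x`-series).  **THE (b3) CELL AS A PAIRING AGAINST THE COMMUTATOR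
WEIGHT**: with `G(x,z) := Σ_{κ₂} Σ_{κ₁} l α x′ κ₁ x · S₀ x z κ₁ κ₂ · r β z′ κ₂ z` (the two legs against the companion),
`push₃ l r (dz λ) S ν U x′ z′ (inl α)(inl β) = Σ'_z Σ'_x G(x,z)·(λ_{νU} z − λ_{νU} x)` — for ANY gauge function (left-leg rows summable, companion and right leg bounded,
`λ_{νU}` bounded). -/
theorem push₃_gaugeTable_eq_tsum_tsum {C₀ Cr : ℝ} (hls : ∀ α x' κ, Summable fun x => l α x' κ x) (hS₀ : ∀ x z a b, |S₀ x z a b| ≤ C₀)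
    (hr : ∀ β z' κ z, |r β z' κ z| ≤ Cr) {lam : Fin (d + 1) → (Fin (d + 1) → ℤ) → (Fin (d + 1) → ℤ) → ℝ} {Lbar : ℝ} (hlam : ∀ ν U y, |lam ν U y| ≤ Lbar)
    (ν : Fin (d + 1)) (U x' z' : Fin (d + 1) → ℤ) (α β : Fin (d + 1)) :
    push₃ l r (fun ν U κ u => dz (lam ν U) κ u) S ν U x' z' (Sum.inl α) (Sum.inl β)
      = ∑' z : Site (d + 1), ∑' x : Site (d + 1),
          (∑ κ₂ : Fin (d + 1), ∑ κ₁ : Fin (d + 1), l α x' κ₁ x * S₀ x z (Sum.inl κ₁) (Sum.inl κ₂) * r β z' κ₂ z) * (lam ν U z - lam ν U x) := by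
  rw [push₃_gaugeTable_inl_inl hWard]
  refine tsum_congr fun z => ?_
  have hw : ∀ x, |lam ν U z - lam ν U x| ≤ 2 * Lbar := fun x => (abs_sub _ _).trans (by linarith [hlam ν U z, hlam ν U x])
  have hsx : ∀ κ₂ κ₁, Summable fun x => l α x' κ₁ x * S₀ x z (Sum.inl κ₁) (Sum.inl κ₂) * r β z' κ₂ z * (lam ν U z - lam ν U x) :=
    fun κ₂ κ₁ => summable_legProd_fst hls hS₀ hr hw α β x' z' z κ₁ κ₂
  calc ∑ κ₂ : Fin (d + 1), (∑' x : Site (d + 1), ∑ κ₁ : Fin (d + 1),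
          l α x' κ₁ x * (S₀ x z (Sum.inl κ₁) (Sum.inl κ₂) * (lam ν U z - lam ν U x))) * r β z' κ₂ z
      = ∑ κ₂ : Fin (d + 1), ∑' x : Site (d + 1), ∑ κ₁ : Fin (d + 1),
          l α x' κ₁ x * S₀ x z (Sum.inl κ₁) (Sum.inl κ₂) * r β z' κ₂ z * (lam ν U z - lam ν U x) := by
        refine Finset.sum_congr rfl fun κ₂ _ => ?_
        rw [← tsum_mul_right]
        refine tsum_congr fun x => ?_
        rw [Finset.sum_mul]
        exact Finset.sum_congr rfl fun κ₁ _ => by ring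
    _ = ∑' x : Site (d + 1), ∑ κ₂ : Fin (d + 1), ∑ κ₁ : Fin (d + 1),
          l α x' κ₁ x * S₀ x z (Sum.inl κ₁) (Sum.inl κ₂) * r β z' κ₂ z * (lam ν U z - lam ν U x) := by
        rw [Summable.tsum_finsetSum (fun κ₂ _ => summable_sum fun κ₁ _ => hsx κ₂ κ₁)]
    _ = _ := by
        refine tsum_congr fun x => ?_
        rw [Finset.sum_mul]
        exact Finset.sum_congr rfl fun κ₂ _ => by rw [Finset.sum_mul]

/-- [folklore] **THE TWO-LEG COMPANION PAIRING IS SUMMABLE ON `Site × Site`** when the left leg's rows are summable, the companion DECAYS off the diagonal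
(`|S₀ x z a b| ≤ C₀·e^{−m‖x−z‖₁}`, `m > 0`) and the right leg is bounded (`summable_prod_of_nonneg` on the majorant `|l|·C₀e^{−m‖x−z‖₁}·Cr`). -/
theorem summable_pairing {C₀ Cr m : ℝ} (hls : ∀ α x' κ, Summable fun x => l α x' κ x) (hm : 0 < m)
    (hS₀ : ∀ x z a b, |S₀ x z a b| ≤ C₀ * Real.exp (-m * B12Sec2to5.l1 (x - z))) (hr : ∀ β z' κ z, |r β z' κ z| ≤ Cr)
    (α β : Fin (d + 1)) (x' z' : Site (d + 1)) :
    Summable fun p : Site (d + 1) × Site (d + 1) =>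
      ∑ κ₂ : Fin (d + 1), ∑ κ₁ : Fin (d + 1), l α x' κ₁ p.1 * S₀ p.1 p.2 (Sum.inl κ₁) (Sum.inl κ₂) * r β z' κ₂ p.2 := by
  have hC₀ : 0 ≤ C₀ := by
    have h := (abs_nonneg _).trans (hS₀ 0 0 (Sum.inl 0) (Sum.inl 0))
    rw [sub_self] at h
    have : Real.exp (-m * B12Sec2to5.l1 (0 : Site (d + 1))) = 1 := by simp [B12Sec2to5.l1]
    rw [this, mul_one] at h
    exact h
  have hCr : 0 ≤ Cr := (abs_nonneg _).trans (hr β z' 0 0)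
  -- majorant: Σκ₂κ₁ |l κ₁ x| · C₀ e^{−m‖x−z‖₁} · Cr
  set g : Site (d + 1) × Site (d + 1) → ℝ := fun p =>
    ∑ κ₂ : Fin (d + 1), ∑ κ₁ : Fin (d + 1), |l α x' κ₁ p.1| * (C₀ * Real.exp (-m * B12Sec2to5.l1 (p.1 - p.2))) * Cr with hg
  have hgs : Summable g := by
    refine summable_sum fun κ₂ _ => summable_sum fun κ₁ _ => ?_
    have hnn : ∀ p : Site (d + 1) × Site (d + 1), 0 ≤ |l α x' κ₁ p.1| * (C₀ * Real.exp (-m * B12Sec2to5.l1 (p.1 - p.2))) * Cr :=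
      fun p => by positivity
    refine (summable_prod_of_nonneg hnn).2 ⟨fun x => ?_, ?_⟩
    · exact ((ExpKernelCalculus.summable_exp_shift hm x).mul_left (|l α x' κ₁ x| * C₀)).mul_right Cr |>.congr fun z => by ring
    · have e : (fun x => ∑' z, |l α x' κ₁ x| * (C₀ * Real.exp (-m * B12Sec2to5.l1 (x - z))) * Cr)
          = fun x => |l α x' κ₁ x| * (C₀ * ExpKernelCalculus.Zl (d + 1) m * Cr) := by
        funext x
        rw [show (fun z => |l α x' κ₁ x| * (C₀ * Real.exp (-m * B12Sec2to5.l1 (x - z))) * Cr)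
            = fun z => (|l α x' κ₁ x| * C₀ * Cr) * Real.exp (-m * B12Sec2to5.l1 (x - z)) from funext fun z => by ring,
          tsum_mul_left, ExpKernelCalculus.tsum_exp_shift]
        ring
      rw [e]
      exact (hls α x' κ₁).abs.mul_right _
  refine Summable.of_norm_bounded hgs (fun p => ?_)
  rw [Real.norm_eq_abs, hg]
  refine (Finset.abs_sum_le_sum_abs _ _).trans (Finset.sum_le_sum fun κ₂ _ => ?_)
  refine (Finset.abs_sum_le_sum_abs _ _).trans (Finset.sum_le_sum fun κ₁ _ => ?_)
  rw [abs_mul, abs_mul]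
  gcongr
  · exact hS₀ _ _ _ _
  · exact hr _ _ _ _

include hWard in
open Classical in
/-- NOT IN PRINT; OUR BOOKKEEPING.  **THE SEAM CELL IS THE SUPERPOSITION, OVER BLOCK LABELS, OF THE TWO-LEG PUSHES OF THE BLOCK-INDICATOR COMMUTATORS** (§3 identity ⨾ §2
decomposition): for the block-constant table gauge `(ν,U) ↦ dz (Λ_{νU} ∘ blk M)` with bounded block values, summable left-leg rows, a companion decaying off the diagonal and a
bounded right leg,
`push₃ l r (dz (Λ∘blk)) S ν U x′ z′ (inl α)(inl β) = Σ'_B Λ_{νU} B · Σ'_z Σ'_x G(x,z)·(𝟙_B z − 𝟙_B x)`, `G(x,z) = Σ_{κ₂κ₁} l·S₀·r` — each summand is the pairing of the two legs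
against the block-INDICATOR commutator `[S₀, 𝟙_B]` (a σ-type letter on the block `B`), weighted by the seam value `Λ_{νU} B`. -/
theorem push₃_blockGauge_eq_tsum_blocks {C₀ Cr m Λbar : ℝ} (hls : ∀ α x' κ, Summable fun x => l α x' κ x) (hm : 0 < m)
    (hS₀ : ∀ x z a b, |S₀ x z a b| ≤ C₀ * Real.exp (-m * B12Sec2to5.l1 (x - z))) (hr : ∀ β z' κ z, |r β z' κ z| ≤ Cr)
    (hΛ : ∀ ν U B, |Λ ν U B| ≤ Λbar) (ν : Fin (d + 1)) (U x' z' : Fin (d + 1) → ℤ) (α β : Fin (d + 1)) :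
    push₃ l r (fun ν U κ u => dz (fun y => Λ ν U (blk M y)) κ u) S ν U x' z' (Sum.inl α) (Sum.inl β)
      = ∑' B : Site (d + 1), Λ ν U B * ∑' z : Site (d + 1), ∑' x : Site (d + 1),
          (∑ κ₂ : Fin (d + 1), ∑ κ₁ : Fin (d + 1), l α x' κ₁ x * S₀ x z (Sum.inl κ₁) (Sum.inl κ₂) * r β z' κ₂ z)
            * ((if blk M z = B then (1 : ℝ) else 0) - (if blk M x = B then (1 : ℝ) else 0)) := by
  have hC₀ : ∀ x z a b, |S₀ x z a b| ≤ C₀ := fun x z a b => by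
    have h := hS₀ x z a b
    have h0 : 0 ≤ C₀ := by
      have h' := (abs_nonneg _).trans (hS₀ 0 0 (Sum.inl 0) (Sum.inl 0))
      rw [sub_self] at h'
      have : Real.exp (-m * B12Sec2to5.l1 (0 : Site (d + 1))) = 1 := by simp [B12Sec2to5.l1]
      rw [this, mul_one] at h'
      exact h'
    exact h.trans (mul_le_of_le_one_right h0 (Real.exp_le_one_iff.2 (by nlinarith [B12Sec2to5.l1_nonneg (x - z)])))
  rw [push₃_gaugeTable_eq_tsum_tsum hWard hls hC₀ hr (lam := fun ν U y => Λ ν U (blk M y)) (fun ν U y => hΛ ν U _) ν U x' z' α β]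
  exact tsum_tsum_mul_blockConst_sub M (fun B => hΛ ν U B)
    (G := fun p : Site (d + 1) × Site (d + 1) => ∑ κ₂ : Fin (d + 1), ∑ κ₁ : Fin (d + 1), l α x' κ₁ p.1 * S₀ p.1 p.2 (Sum.inl κ₁) (Sum.inl κ₂) * r β z' κ₂ p.2)
    (summable_pairing hls hm hS₀ hr α β x' z')

end Cell

end Summit.QuantumFields.BalabanUV.Beta.GAN24.LayerSeamLettersFubini

end
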